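import Literature.MathematicalPhysics.QuantumFieldTheory.Balaban1983to89.B9SectDSup

/-!
# `Balaban1983to89.B9Ineq3133Assembly` — B9 p. 422, inequality (3.133): the printed hence-step *"The above inequality
# [(3.132)] together with Theorem 3.3 for G … give (3.133)"* — the kernel bounds of H = GQ*(QGQ*)⁻¹ (3.126) ASSEMBLED from the
# (3.132)-shape bound on (QGQ*)⁻¹ and Theorem-3.3-shape entries of G on the block test functions, by one scale transfer ([4] (2.60),
# the p. 398 remark) and one convolution ([4] (2.54) + Lemma 2.1 (2.61)), over abstract localized seminorms (sup AND Hölder entries at once)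

statement-level skeleton of published theorems with citation tags; proofs where landed; nothing here is a claim about the Yang–Mills mass gap

T. Bałaban, *Propagators for lattice gauge theories in a background field*, Commun. Math. Phys. **99** (1985) 389–434
[Balaban1985BackgroundPropagators] (cell paper B9; PDF held `paper:balaban1985-cmp99-background-propagators`, journal page = PDF page
+ 388; pp. 397–399, 420, 422 = renders `…-p009…p011-x2.png`, `…-p032-x2.png`, `…-p034-x2.png`, READ AS IMAGES by this seat,
2026-08-21), and T. Bałaban, *Propagators and renormalization transformations for lattice gauge theories. II*, Commun. Math. Phys.
**96** (1984) 223–250 [Balaban1984PropagatorsII] (= ref. [4] of B9), Lemma 2.1 p. 234, (2.54) p. 233.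
Cell `lit-balaban`, SKELETON row **B9.Eq3.133** (typed-existing as the hypothesis shape `B9.Ineq3133` of `B9.Thm312Printed`; consumed by
p10's `B9Delta2Def134.ineq3137a_of_3133_336`); reader/typer seat r06 (B9 block owner), gen 3.  Referee ref-4.

CITATION HEADER / WHAT IS IN PRINT.  (3.126) p. 420: *"HB = GQ*(QGQ*)^{−1}B. (3.126)"*.  p. 422: *"We have |(QGQ*)^{−1}(y, y′)| ≦
O(1)(L^jη)^{−2}(L^{j′}η)^{−d}e^{−δ₁d(y,y′)} for y ∈ Λ_j, y′ ∈ Λ_{j′}, (3.132) and the same for the operator with G₁ instead of G. The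
above inequality together with Theorem 3.3 for G, with the exception of the inequality involving the covariant Laplace operator in (3.42),
give |H_{μν}(x, y′)|, |∇H_{μν}(x, y′)|, ‖ζ∇H(·, y′)‖_β ≦ O(1)[1, (L^jη)^{−1}, (‖ζ‖^ξ_β + |ζ|)(L^jη)^{−1−β}](L^{j′}η)^{−d}e^{−(1/2)δ₁d(y,y′)},
for x ∈ Δ(y), or ζ ∈ C^∞₀(Δ̃(y)), y ∈ Λ_j, y′ ∈ Λ_{j′}. (3.133)"*.  Theorem 3.3 p. 399: *"the operator G(U) (a = 1) satisfies the
inequalities (3.42)–(3.47), with G′(U) replaced by G(U) and λ replaced by a function J defined at bonds"*; (3.42) p. 397: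
*"|(G′(U)λ)(x)|, |(∇_UG′(U)λ)(x)|, … ≦ B₀[(L^jη)², L^jη, L^jη, 1]e^{−δ₀d(y,y′)}|λ| for x ∈ Δ(y), y ∈ Λ_j, supp λ ⊂ Δ(y′)"*;
(3.43) p. 398: *"‖ζ∇_UG′(U)λ‖_β, ‖ζG′(U)∇*_Uλ‖_β ≦ B₀(β₀)(L^jη)^{1−β}·(‖ζ‖^ξ_β + |ζ|)e^{−δ₀d(y,y′)}|λ|"*; the p. 398 remark *"Using
Lemma 2.1 in [4] we may replace the factor (L^jη)^α by (L^jη)^β(L^{j′}η)^γ with β + γ = α"*; [4] (2.54), Lemma 2.1 (2.60)–(2.61).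

WHAT THIS FILE PROVES (0 sorry; NO new `def … : Prop`; one def with body, `hKer`).
* §1 `hKer gv K y′ = Σ_{y″} K(y″,y′) • g_{y″}` — the kernel column of H at the coarse site y′, where `g_{y″} ∈ F` stands for the fine bond
  function `G(Q*1_{y″})` (G applied to the transported indicator of the block Δ(y″)) and `K(y″,y′)` for the kernel of (QGQ*)⁻¹ — and
  **`eq3126_kernel`**: for ANY linear `GQ : (𝔅 → ℝ) →ₗ F` (the composite G∘Q*) and any coarse weights `w` (the pairing `Σ_{y′} w(y′)·`),
  `GQ(K·B) = Σ_{y′} (w(y′)B(y′)) • hKer (GQ 1_{·}) K y′` — i.e. `hKer` IS the kernel of (3.126) (finite linear algebra, exact).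
* §2 `seminorm_hKer_le`: every seminorm passes through the column, `p(H(·,y′)) ≦ Σ_{y″} |K(y″,y′)|·p(g_{y″})`.
* §3 **`ineq3133_assembled`**: for a family of seminorms `p_y` on the fine bond functions (one per observation cube — sup over Δ(y), sup of ∇
  over Δ(y), the Hölder functional ‖ζ∇·‖_β with ζ ∈ C₀^∞(Δ̃(y)) are all instances) obeying the Theorem-3.3 shape
  `p_y(g_{y″}) ≦ Π(y)·(L^jη)²·e^{−δ_Gd(y,y″)}` (Π ≧ 0 the entry's prefactor: B₀, B₀(L^jη)^{−1}, B₀(β)(‖ζ‖_β + |ζ|)(L^jη)^{−1−β}) and a kernel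
  of the (3.132) shape `|K(y″,y′)| ≦ C_K(L^{j″}η)^{−2}(L^{j′}η)^{−d}e^{−δ_Kd(y″,y′)}`, under the geometry of [4] (d ≧ 0 symmetric, (2.54), row sum
  (2.61) at rate σ with constant c, (2.60) at rate αδ₀ with 2 log L ≦ αδ₀RM, L ≧ 1, η > 0): for every rate `ρ ≧ 0` with `ρ ≦ δ_K` and
  `ρ + σ + αδ₀ ≦ δ_G`, `p_y(H(·,y′)) ≦ Π(y)·C_K·L²·c·(L^{j′}η)^{−d}·e^{−ρd(y,y′)}` — ONE transfer (L^jη)² → (L^{j″}η)² and ONE convolution.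
* §4 **`ineq3133_printed`** (rate ½δ₁ under ½δ₁ + σ + αδ₀ ≦ δ₀, δ_G = δ₀) and the two printed prefactor families:
  `ineq3133_printed_sup` (n = 0, 1: `[1, (L^jη)^{−1}]`) and `ineq3133_printed_holder` (`(‖ζ‖_β + |ζ|)(L^jη)^{−1−β}`), i.e. the three
  members of (3.133) in the shape of `B9.Ineq3133` ((L^{j′}η)^{−d} as `(g.len y′ ^ d)⁻¹`, e^{−(δ₁/2)d(y,y′)}).
NOT REPRODUCED (said once): Theorem 3.3 for the Sect.-D operator G and (3.132) themselves (statement rows `B9.Thm33Printed`/`B9.Thm312Printed`,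
`B9.Stmt3132Printed`; here hypotheses of the printed shape); the concrete H (the carriers of `B9SectDFP`/`B9Thm311` do not meet the
multiscale geometry in the tree); the rate bookkeeping behind the print's ½δ₁ beyond the one transfer + one convolution spent here (general
rates in §3; the paper's δ's are generic constants re-defined on pp. 423–424, cell DIVERGENCE D-r1.2).  Value = a printed "give" made a
kernel-checked implication with O(1) explicit; NOT summit progress.
-/

noncomputable section

namespace Literature.MathematicalPhysics.QuantumFieldTheory.Balaban1983to89.B9Ineq3133Assembly

open Literature.MathematicalPhysics.QuantumFieldTheory.Balaban1983to89
open Literature.MathematicalPhysics.QuantumFieldTheory.Balaban1983to89.B6RandomWalk (Triangle254 Ineq260)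
open Literature.MathematicalPhysics.QuantumFieldTheory.Balaban1983to89.B11SectG (RowSum conv_exp_le)
open Literature.MathematicalPhysics.QuantumFieldTheory.Balaban1983to89.B9SectDSup (DistSymm)

variable {g : B6.Geometry}

/-! ## §1 The kernel column of H = GQ*(QGQ*)⁻¹ and the identity behind it -/

section Kernel

variable {F : Type*} [AddCommGroup F] [Module ℝ F]

/-- **The kernel column of H (3.126) at the coarse site y′**: `H(·, y′) = Σ_{y″ ∈ 𝔅} (QGQ*)⁻¹(y″, y′) · G(Q*1_{y″})` — with
`gv y″ ∈ F` the fine bond function `G(Q*1_{y″})` and `K` the kernel of `(QGQ*)⁻¹`. [cite: Balaban1985BackgroundPropagators, (3.126) p.420, (3.133) p.422] -/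
def hKer (gv : g.Site → F) (K : g.Site → g.Site → ℝ) (y' : g.Site) : F := ∑ y'', K y'' y' • gv y''

/-- `hKer` unfolded. [cite: Balaban1985BackgroundPropagators, (3.126) p.420] -/
theorem hKer_def (gv : g.Site → F) (K : g.Site → g.Site → ℝ) (y' : g.Site) :
    hKer gv K y' = ∑ y'', K y'' y' • gv y'' := rfl

open Classical in
/-- **(3.126) in kernel form** (finite linear algebra, exact): for any linear map `GQ` from coarse functions to fine bond functions (the
composite `G ∘ Q*`) and the operator `(KB)(y″) = Σ_{y′} w(y′)K(y″,y′)B(y′)` on coarse functions (`w` = the weights of the coarse pairing),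
`GQ(KB) = Σ_{y′} (w(y′)B(y′)) • hKer (y″ ↦ GQ 1_{y″}) K y′` — so `hKer` is the kernel of `H = GQ*(QGQ*)⁻¹` against the coarse pairing.
[cite: Balaban1985BackgroundPropagators, (3.126) p.420] -/
theorem eq3126_kernel (GQ : (g.Site → ℝ) →ₗ[ℝ] F) (K : g.Site → g.Site → ℝ) (w B : g.Site → ℝ) :
    GQ (fun y'' => ∑ y', w y' * K y'' y' * B y')
      = ∑ y', (w y' * B y') • hKer (fun y'' => GQ (fun j => if y'' = j then 1 else 0)) K y' := by
  have hexp : (fun y'' => ∑ y', w y' * K y'' y' * B y')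
      = ∑ y'', (∑ y', w y' * K y'' y' * B y') • (fun j => if y'' = j then (1 : ℝ) else 0) :=
    pi_eq_sum_univ _
  rw [hexp, map_sum]
  simp only [map_smul, hKer, Finset.smul_sum, smul_smul]
  rw [Finset.sum_comm]
  refine Finset.sum_congr rfl fun y'' _ => ?_
  rw [Finset.sum_smul]
  refine Finset.sum_congr rfl fun y' _ => ?_
  congr 1
  ring

/-! ## §2 Seminorms pass through the column -/

/-- Every seminorm passes through the kernel column: `p(H(·,y′)) ≦ Σ_{y″} |(QGQ*)⁻¹(y″,y′)|·p(G(Q*1_{y″}))` (subadditivity and absolute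
homogeneity — valid for the sup entries and the Hölder entries of (3.133) alike). [cite: Balaban1985BackgroundPropagators, (3.133) p.422] -/
theorem seminorm_hKer_le (p : Seminorm ℝ F) (gv : g.Site → F) (K : g.Site → g.Site → ℝ) (y' : g.Site) :
    p (hKer gv K y') ≤ ∑ y'', |K y'' y'| * p (gv y'') := by
  rw [hKer]
  refine (Finset.le_sum_of_subadditive p (map_zero p).le (fun a b => map_add_le_add p a b) _ _).trans (le_of_eq ?_)
  refine Finset.sum_congr rfl fun y'' _ => ?_
  rw [map_smul_eq_mul, Real.norm_eq_abs]

end Kernel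

/-! ## §3 The assembly of (3.133) -/

section Assembly

variable {F : Type*} [AddCommGroup F] [Module ℝ F]

/-- Lengths are positive for `L ≧ 1`, `η > 0` (private plumbing). [folklore] -/
private theorem len_pos' (hL : 1 ≤ g.L) (hη : 0 < g.eta) (y : g.Site) : 0 < g.len y := by
  rw [B6.Geometry.len]
  exact mul_pos (pow_pos (lt_of_lt_of_le one_pos hL) _) hη

/-- **(3.133) ASSEMBLED** (p. 422: *"The above inequality [(3.132)] together with Theorem 3.3 for G … give (3.133)"*).  Data: the multiscale
geometry 𝔅 of [4] (`g`), a real vector space `F` of fine bond functions, a family of seminorms `p y` on `F` (the entry functional localized at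
the observation cube Δ(y) — `sup_{x∈Δ(y)}|·|`, `sup_{x∈Δ(y)}|∇·|`, or `‖ζ∇·‖_β` with ζ ∈ C₀^∞(Δ̃(y))), the vectors `gv y″ = G(Q*1_{y″})` and the
kernel `K = (QGQ*)⁻¹`.  Inputs of the printed shapes: `hG` = Theorem 3.3 ((3.42)/(3.43) for G with `λ = Q*1_{y″}`, `|λ| ≦ 1`, supp λ ⊂ Δ(y″)):
`p_y(gv y″) ≦ Π(y)(L^jη)²e^{−δ_Gd(y,y″)}`; `hK` = (3.132): `|K(y″,y′)| ≦ C_K(L^{j″}η)^{−2}(L^{j′}η)^{−d}e^{−δ_Kd(y″,y′)}`; geometry: `d ≧ 0`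
symmetric, (2.54), the row sum (2.61) at rate `σ`, (2.60) at rate `αδ₀` with `2 log L ≦ αδ₀RM`, `L ≧ 1`, `η > 0`.  Conclusion, for every
rate `ρ ≧ 0` with `ρ ≦ δ_K`, `ρ + σ + αδ₀ ≦ δ_G`: `p_y(H(·,y′)) ≦ Π(y)·C_K·L²·c·(L^{j′}η)^{−d}·e^{−ρd(y,y′)}`.
[cite: Balaban1985BackgroundPropagators, (3.133) p.422, (3.132) p.422, (3.126) p.420, Thm 3.3 p.399, (3.42)–(3.43) pp.397–398, p.398; Balaban1984PropagatorsII, Lemma 2.1 (2.60)–(2.61) p.234, (2.54) p.233] -/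
theorem ineq3133_assembled (d : ℕ) (p : g.Site → Seminorm ℝ F) (gv : g.Site → F) (K : g.Site → g.Site → ℝ)
    (hd : ∀ a b : g.Site, 0 ≤ g.dist a b) (hsym : DistSymm g) (htri : Triangle254 g)
    {σ c δ₀ α : ℝ} (hrow : RowSum g σ c) (h260 : Ineq260 g δ₀ α) (hαδ : 0 ≤ α * δ₀)
    (hL : 1 ≤ g.L) (hge : 0 < g.eta) (hRM : 2 * Real.log g.L ≤ α * δ₀ * g.R * g.M)
    {δG δK ρ : ℝ} (hρ : 0 ≤ ρ) (hρK : ρ ≤ δK) (hρG : ρ + σ + α * δ₀ ≤ δG)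
    {Pf : g.Site → ℝ} (hPf : ∀ y, 0 ≤ Pf y) {CK : ℝ} (hCK : 0 ≤ CK)
    (hG : ∀ y y'', p y (gv y'') ≤ Pf y * g.len y ^ 2 * Real.exp (-(δG * g.dist y y'')))
    (hK : ∀ y'' y', |K y'' y'| ≤ CK * (g.len y'' ^ 2)⁻¹ * (g.len y' ^ d)⁻¹ * Real.exp (-(δK * g.dist y'' y')))
    (y y' : g.Site) :
    p y (hKer gv K y') ≤ Pf y * CK * g.L ^ 2 * c * (g.len y' ^ d)⁻¹ * Real.exp (-(ρ * g.dist y y')) := by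
  have hlen : ∀ z : g.Site, 0 < g.len z := len_pos' hL hge
  have hLnn : 0 ≤ g.L := le_trans zero_le_one hL
  have hld : 0 ≤ (g.len y' ^ d)⁻¹ := inv_nonneg.mpr (pow_nonneg (hlen y').le d)
  -- one transfer: (L^jη)²/(L^{j″}η)² ≦ L² e^{αδ₀ d(y,y″)}  ([4] (2.60), the p. 398 remark)
  have htr : ∀ y'', (g.len y'' ^ 2)⁻¹ * g.len y ^ 2 ≤ g.L ^ 2 * Real.exp (α * δ₀ * g.dist y y'') := by
    intro y''
    have hRM2 : ((2 : ℕ) : ℝ) * Real.log g.L ≤ α * δ₀ * g.R * g.M := by push_cast; linarith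
    have h := B9SectDL2Decay.len_pow_le_of_ineq260 h260 hαδ hd hL hge.le 2 hRM2 y'' y
    rw [hsym y'' y] at h
    rw [inv_mul_le_iff₀ (pow_pos (hlen y'') 2)]
    calc g.len y ^ 2 ≤ g.L ^ 2 * g.len y'' ^ 2 * Real.exp (α * δ₀ * g.dist y y'') := h
      _ = g.len y'' ^ 2 * (g.L ^ 2 * Real.exp (α * δ₀ * g.dist y y'')) := by ring
  -- term by term
  have hterm : ∀ y'', |K y'' y'| * p y (gv y'')
      ≤ Pf y * CK * (g.len y' ^ d)⁻¹ * g.L ^ 2 *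
          (Real.exp (-((δG - α * δ₀) * g.dist y y'')) * Real.exp (-(δK * g.dist y'' y'))) := by
    intro y''
    have h1 := hK y'' y'
    have h2 := hG y y''
    have hK0 : 0 ≤ CK * (g.len y'' ^ 2)⁻¹ * (g.len y' ^ d)⁻¹ * Real.exp (-(δK * g.dist y'' y')) :=
      mul_nonneg (mul_nonneg (mul_nonneg hCK (inv_nonneg.mpr (pow_nonneg (hlen y'').le 2))) hld) (Real.exp_nonneg _)
    calc |K y'' y'| * p y (gv y'')
        ≤ (CK * (g.len y'' ^ 2)⁻¹ * (g.len y' ^ d)⁻¹ * Real.exp (-(δK * g.dist y'' y'))) *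
            (Pf y * g.len y ^ 2 * Real.exp (-(δG * g.dist y y''))) := mul_le_mul h1 h2 (apply_nonneg _ _) hK0
      _ = Pf y * CK * (g.len y' ^ d)⁻¹ * ((g.len y'' ^ 2)⁻¹ * g.len y ^ 2) *
            (Real.exp (-(δG * g.dist y y'')) * Real.exp (-(δK * g.dist y'' y'))) := by ring
      _ ≤ Pf y * CK * (g.len y' ^ d)⁻¹ * (g.L ^ 2 * Real.exp (α * δ₀ * g.dist y y'')) *
            (Real.exp (-(δG * g.dist y y'')) * Real.exp (-(δK * g.dist y'' y'))) :=
          mul_le_mul_of_nonneg_right (mul_le_mul_of_nonneg_left (htr y'') (mul_nonneg (mul_nonneg (hPf y) hCK) hld))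
            (mul_nonneg (Real.exp_nonneg _) (Real.exp_nonneg _))
      _ = Pf y * CK * (g.len y' ^ d)⁻¹ * g.L ^ 2 *
            ((Real.exp (α * δ₀ * g.dist y y'') * Real.exp (-(δG * g.dist y y''))) * Real.exp (-(δK * g.dist y'' y'))) := by
          ring
      _ = Pf y * CK * (g.len y' ^ d)⁻¹ * g.L ^ 2 *
            (Real.exp (-((δG - α * δ₀) * g.dist y y'')) * Real.exp (-(δK * g.dist y'' y'))) := by
          rw [← Real.exp_add]
          congr 3
          ring
  -- one convolution ([4] (2.54) + (2.61))
  have hconv := conv_exp_le (ρ₁ := δG - α * δ₀) (ρ₂ := δK) htri hd hrow hρ hρK (by linarith) y y'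
  have hc : 0 ≤ c := hrow.nonneg y
  calc p y (hKer gv K y') ≤ ∑ y'', |K y'' y'| * p y (gv y'') := seminorm_hKer_le (p y) gv K y'
    _ ≤ ∑ y'', Pf y * CK * (g.len y' ^ d)⁻¹ * g.L ^ 2 *
          (Real.exp (-((δG - α * δ₀) * g.dist y y'')) * Real.exp (-(δK * g.dist y'' y'))) :=
        Finset.sum_le_sum fun y'' _ => hterm y''
    _ = Pf y * CK * (g.len y' ^ d)⁻¹ * g.L ^ 2 *
          ∑ y'', Real.exp (-((δG - α * δ₀) * g.dist y y'')) * Real.exp (-(δK * g.dist y'' y')) := by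
        rw [Finset.mul_sum]
    _ ≤ Pf y * CK * (g.len y' ^ d)⁻¹ * g.L ^ 2 * (c * Real.exp (-(ρ * g.dist y y'))) :=
        mul_le_mul_of_nonneg_left hconv (mul_nonneg (mul_nonneg (mul_nonneg (hPf y) hCK) hld) (pow_nonneg hLnn 2))
    _ = Pf y * CK * g.L ^ 2 * c * (g.len y' ^ d)⁻¹ * Real.exp (-(ρ * g.dist y y')) := by ring

/-! ## §4 (3.133) letter for letter: rate ½δ₁ and the printed prefactors -/

/-- **(3.133) at the printed rate**: with `δ_G = δ₀` (Theorem 3.3), `δ_K = δ₁` ((3.132)) and the rate budget `½δ₁ + σ + αδ₀ ≦ δ₀`,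
`p_y(H(·,y′)) ≦ Π(y)·C_K·L²·c·(L^{j′}η)^{−d}·e^{−(δ₁/2)d(y,y′)}` — the shape of `B9.Ineq3133` for an arbitrary entry prefactor Π ≧ 0.
[cite: Balaban1985BackgroundPropagators, (3.133) p.422, (3.132) p.422, Thm 3.3 p.399; Balaban1984PropagatorsII, Lemma 2.1 (2.60)–(2.61) p.234] -/
theorem ineq3133_printed (d : ℕ) (p : g.Site → Seminorm ℝ F) (gv : g.Site → F) (K : g.Site → g.Site → ℝ)
    (hd : ∀ a b : g.Site, 0 ≤ g.dist a b) (hsym : DistSymm g) (htri : Triangle254 g)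
    {σ c δ₀ α : ℝ} (hrow : RowSum g σ c) (h260 : Ineq260 g δ₀ α) (hαδ : 0 ≤ α * δ₀)
    (hL : 1 ≤ g.L) (hge : 0 < g.eta) (hRM : 2 * Real.log g.L ≤ α * δ₀ * g.R * g.M)
    {δ₁ : ℝ} (hδ₁ : 0 ≤ δ₁) (hbudget : δ₁ / 2 + σ + α * δ₀ ≤ δ₀)
    {Pf : g.Site → ℝ} (hPf : ∀ y, 0 ≤ Pf y) {CK : ℝ} (hCK : 0 ≤ CK)
    (hG : ∀ y y'', p y (gv y'') ≤ Pf y * g.len y ^ 2 * Real.exp (-(δ₀ * g.dist y y'')))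
    (hK : ∀ y'' y', |K y'' y'| ≤ CK * (g.len y'' ^ 2)⁻¹ * (g.len y' ^ d)⁻¹ * Real.exp (-(δ₁ * g.dist y'' y')))
    (y y' : g.Site) :
    p y (hKer gv K y') ≤ Pf y * CK * g.L ^ 2 * c * (g.len y' ^ d)⁻¹ * Real.exp (-(δ₁ / 2 * g.dist y y')) :=
  ineq3133_assembled d p gv K hd hsym htri hrow h260 hαδ hL hge hRM (ρ := δ₁ / 2) (by linarith) (by linarith)
    (by linarith) hPf hCK hG hK y y'

/-- **(3.133), the two sup members** (n = 0: `|H_{μν}(x,y′)|`, n = 1: `|∇H_{μν}(x,y′)|`): from the Theorem 3.3 entries (3.42)₁,₂ for G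
(`p⁽ⁿ⁾_y(G Q*1_{y″}) ≦ B₀(L^jη)^{2−n}e^{−δ₀d(y,y″)}`) and (3.132):
`p⁽ⁿ⁾_y(H(·,y′)) ≦ B₀C_KL²c·(L^jη)^{−n}(L^{j′}η)^{−d}e^{−(δ₁/2)d(y,y′)}` — the printed `O(1)[1, (L^jη)^{−1}](L^{j′}η)^{−d}e^{−(1/2)δ₁d(y,y′)}`.
[cite: Balaban1985BackgroundPropagators, (3.133) p.422, (3.42) p.397, (3.132) p.422] -/
theorem ineq3133_printed_sup (d : ℕ) (n : Fin 2) (p : g.Site → Seminorm ℝ F) (gv : g.Site → F) (K : g.Site → g.Site → ℝ)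
    (hd : ∀ a b : g.Site, 0 ≤ g.dist a b) (hsym : DistSymm g) (htri : Triangle254 g)
    {σ c δ₀ α : ℝ} (hrow : RowSum g σ c) (h260 : Ineq260 g δ₀ α) (hαδ : 0 ≤ α * δ₀)
    (hL : 1 ≤ g.L) (hge : 0 < g.eta) (hRM : 2 * Real.log g.L ≤ α * δ₀ * g.R * g.M)
    {δ₁ : ℝ} (hδ₁ : 0 ≤ δ₁) (hbudget : δ₁ / 2 + σ + α * δ₀ ≤ δ₀)
    {B₀ CK : ℝ} (hB₀ : 0 ≤ B₀) (hCK : 0 ≤ CK)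
    (hG : ∀ y y'', p y (gv y'') ≤ B₀ * (g.len y)⁻¹ ^ (n : ℕ) * g.len y ^ 2 * Real.exp (-(δ₀ * g.dist y y'')))
    (hK : ∀ y'' y', |K y'' y'| ≤ CK * (g.len y'' ^ 2)⁻¹ * (g.len y' ^ d)⁻¹ * Real.exp (-(δ₁ * g.dist y'' y')))
    (y y' : g.Site) :
    p y (hKer gv K y') ≤
      B₀ * CK * g.L ^ 2 * c * (g.len y)⁻¹ ^ (n : ℕ) * (g.len y' ^ d)⁻¹ * Real.exp (-(δ₁ / 2 * g.dist y y')) := by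
  have hlen : ∀ z : g.Site, 0 < g.len z := len_pos' hL hge
  have hPf : ∀ z : g.Site, 0 ≤ B₀ * (g.len z)⁻¹ ^ (n : ℕ) := fun z =>
    mul_nonneg hB₀ (pow_nonneg (inv_nonneg.mpr (hlen z).le) _)
  have h := ineq3133_printed d p gv K hd hsym htri hrow h260 hαδ hL hge hRM hδ₁ hbudget
    (Pf := fun z => B₀ * (g.len z)⁻¹ ^ (n : ℕ)) hPf hCK hG hK y y'
  calc p y (hKer gv K y')
      ≤ B₀ * (g.len y)⁻¹ ^ (n : ℕ) * CK * g.L ^ 2 * c * (g.len y' ^ d)⁻¹ * Real.exp (-(δ₁ / 2 * g.dist y y')) := h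
    _ = B₀ * CK * g.L ^ 2 * c * (g.len y)⁻¹ ^ (n : ℕ) * (g.len y' ^ d)⁻¹ * Real.exp (-(δ₁ / 2 * g.dist y y')) := by ring

/-- **(3.133), the Hölder member** `‖ζ∇H(·,y′)‖_β` (ζ ∈ C₀^∞(Δ̃(y))): from the Theorem 3.3 entry (3.43) for G
(`p^ζ_y(G Q*1_{y″}) ≦ B₀(β)(‖ζ‖^ξ_β + |ζ|)(L^jη)^{1−β}e^{−δ₀d(y,y″)}`, written with `(L^jη)^{1−β} = (L^jη)^{−(1+β)}·(L^jη)²`) and (3.132):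
`p^ζ_y(H(·,y′)) ≦ B₀(β)C_KL²c·(‖ζ‖^ξ_β + |ζ|)(L^jη)^{−(1+β)}(L^{j′}η)^{−d}e^{−(δ₁/2)d(y,y′)}` — the printed third member.
[cite: Balaban1985BackgroundPropagators, (3.133) p.422, (3.43) p.398, (3.132) p.422] -/
theorem ineq3133_printed_holder (d : ℕ) (β : ℝ) (p : g.Site → Seminorm ℝ F) (gv : g.Site → F) (K : g.Site → g.Site → ℝ)
    (hd : ∀ a b : g.Site, 0 ≤ g.dist a b) (hsym : DistSymm g) (htri : Triangle254 g)
    {σ c δ₀ α : ℝ} (hrow : RowSum g σ c) (h260 : Ineq260 g δ₀ α) (hαδ : 0 ≤ α * δ₀)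
    (hL : 1 ≤ g.L) (hge : 0 < g.eta) (hRM : 2 * Real.log g.L ≤ α * δ₀ * g.R * g.M)
    {δ₁ : ℝ} (hδ₁ : 0 ≤ δ₁) (hbudget : δ₁ / 2 + σ + α * δ₀ ≤ δ₀)
    {Bβ Zζ CK : ℝ} (hBβ : 0 ≤ Bβ) (hZζ : 0 ≤ Zζ) (hCK : 0 ≤ CK)
    (hG : ∀ y y'', p y (gv y'') ≤ Bβ * Zζ * (g.len y) ^ (-(1 + β)) * g.len y ^ 2 * Real.exp (-(δ₀ * g.dist y y'')))
    (hK : ∀ y'' y', |K y'' y'| ≤ CK * (g.len y'' ^ 2)⁻¹ * (g.len y' ^ d)⁻¹ * Real.exp (-(δ₁ * g.dist y'' y')))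
    (y y' : g.Site) :
    p y (hKer gv K y') ≤
      Bβ * CK * g.L ^ 2 * c * Zζ * (g.len y) ^ (-(1 + β)) * (g.len y' ^ d)⁻¹ * Real.exp (-(δ₁ / 2 * g.dist y y')) := by
  have hlen : ∀ z : g.Site, 0 < g.len z := len_pos' hL hge
  have hPf : ∀ z : g.Site, 0 ≤ Bβ * Zζ * (g.len z) ^ (-(1 + β)) := fun z =>
    mul_nonneg (mul_nonneg hBβ hZζ) (Real.rpow_nonneg (hlen z).le _)
  have h := ineq3133_printed d p gv K hd hsym htri hrow h260 hαδ hL hge hRM hδ₁ hbudget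
    (Pf := fun z => Bβ * Zζ * (g.len z) ^ (-(1 + β))) hPf hCK hG hK y y'
  calc p y (hKer gv K y')
      ≤ Bβ * Zζ * (g.len y) ^ (-(1 + β)) * CK * g.L ^ 2 * c * (g.len y' ^ d)⁻¹ * Real.exp (-(δ₁ / 2 * g.dist y y')) := h
    _ = Bβ * CK * g.L ^ 2 * c * Zζ * (g.len y) ^ (-(1 + β)) * (g.len y' ^ d)⁻¹ * Real.exp (-(δ₁ / 2 * g.dist y y')) := by
        ring

end Assembly

end Literature.MathematicalPhysics.QuantumFieldTheory.Balaban1983to89.B9Ineq3133Assembly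

end
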